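import Summits.QuantumFields.QCD.Theses.HeatSlicedQuarks
import Literature.MathematicalPhysics.QuantumFieldTheory.QCD

/-!
# Wilson–Lichnerowicz bound (item stmt-QuantumFields-8874, route HeatSlicedQuarks): definitions

Objects used by the proof of the support item `WilsonLichnerowicz`
(`Summit.QuantumFields.QCD.Theses.HeatSlicedQuarks.WilsonLichnerowicz`), the lattice Lichnerowicz
form bound `½⟨v, K_U v⟩ ≤ ‖D_W v‖² + C Σ_x V(U,x)|v(x)|²` for Wilson fermions in an `SU(3)`
background on the four-torus.  No statements of the route are restated here; these are proof-side
abbreviations only: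

* quark fields `Fld L = TorusSite 4 L × Fin 3 × Fin 4 → ℂ`, the `ℓ²` pairing `ip`, squared norm
  `nsq`, site norms `siteSq`;
* `transport G e` (colour-matrix field `G`, site offset `e`), `spin Γ` (a `4 × 4` matrix on the spin
  index), the covariant shifts `fwd U μ = T_μ`, `bwd U μ = T_μ†`, the covariant Laplacian
  `lapK U μ = 2 - T_μ - T_μ†`, the anti-Hermitian difference `asym U μ = T_μ - T_μ†`, and the Wilson
  hopping term `hop U μ = ½(lapK + γ_μ ∘ asym)` (so that `D_W v = m v + Σ_μ hop U μ v`,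
  proved in the sibling `…Dirac` file);
* the curvature potential `curv U x = Σ_{dist(x,y) ≤ 3} Σ_{μ,ν} √(3 - Re tr U_p(y;μ,ν))` of the
  item (verbatim) and the weighted mass `phi U v = Σ_x curv U x · siteSq v x`.

Proofs live in the sibling files `HeatSlicedQuarksWilsonLichnerowicz{Inner,Links,Dirac,Shapes}.lean`
and the closing file `HeatSlicedQuarksWilsonLichnerowicz.lean` (Mathlib + the tree's `wilsonDirac`,
`euclideanGamma`, `plaquetteHolonomy`, `torusDist`; no named facts).
-/

noncomputable section

namespace Summit.QuantumFields.QCD.Theorems.WilsonLichnerowicz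

open Literature.Probability.LatticeModels Matrix
open scoped ComplexConjugate

variable {L : ℕ}

/-- Quark fields on the four-torus of side `L`: site × colour × spin components. -/
abbrev Fld (L : ℕ) : Type := TorusSite 4 L × Fin 3 × Fin 4 → ℂ

/-! ## Norms and the `ℓ²` pairing -/

/-- The squared norm of the colour–spin vector of `u` at the site `x`. -/
def siteSq (u : Fld L) (x : TorusSite 4 L) : ℝ := ∑ a, ∑ α, ‖u (x, a, α)‖ ^ 2

section Inner

variable [NeZero L]

/-- The `ℓ²` inner product `⟨u, w⟩ = Σ_i conj(u i) w i` (conjugate-linear in the first slot). -/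
def ip (u w : Fld L) : ℂ := ∑ i, conj (u i) * w i

/-- The squared `ℓ²` norm `Σ_i ‖u i‖²`. -/
def nsq (u : Fld L) : ℝ := ∑ i, ‖u i‖ ^ 2

end Inner

/-! ## Transports and spin matrices -/

/-- The transport by the colour-matrix field `G` with site offset `e`:
`(transport G e u)(x,a,α) = Σ_b G(x)_{ab} u(x+e,b,α)`, as a `ℂ`-linear map. -/
def transport (G : TorusSite 4 L → Matrix (Fin 3) (Fin 3) ℂ) (e : TorusSite 4 L) :
    Fld L →ₗ[ℂ] Fld L where
  toFun u := fun p => ∑ b, G p.1 p.2.1 b * u (p.1 + e, b, p.2.2)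
  map_add' u w := by
    funext p
    simp only [Pi.add_apply, mul_add, Finset.sum_add_distrib]
  map_smul' c u := by
    funext p
    simp only [Pi.smul_apply, smul_eq_mul, RingHom.id_apply, Finset.mul_sum]
    exact Finset.sum_congr rfl fun b _ => by ring

/-- Pointwise formula for `transport`. -/
theorem transport_apply (G : TorusSite 4 L → Matrix (Fin 3) (Fin 3) ℂ) (e : TorusSite 4 L)
    (u : Fld L) (p : TorusSite 4 L × Fin 3 × Fin 4) :
    transport G e u p = ∑ b, G p.1 p.2.1 b * u (p.1 + e, b, p.2.2) := rfl

/-- The action of a `4 × 4` matrix on the spin index: `(spin Γ u)(x,a,α) = Σ_β Γ_{αβ} u(x,a,β)`. -/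
def spin (Γ : Matrix (Fin 4) (Fin 4) ℂ) : Fld L →ₗ[ℂ] Fld L where
  toFun u := fun p => ∑ β, Γ p.2.2 β * u (p.1, p.2.1, β)
  map_add' u w := by
    funext p
    simp only [Pi.add_apply, mul_add, Finset.sum_add_distrib]
  map_smul' c u := by
    funext p
    simp only [Pi.smul_apply, smul_eq_mul, RingHom.id_apply, Finset.mul_sum]
    exact Finset.sum_congr rfl fun b _ => by ring

/-- Pointwise formula for `spin`. -/
theorem spin_apply (Γ : Matrix (Fin 4) (Fin 4) ℂ) (u : Fld L) (p : TorusSite 4 L × Fin 3 × Fin 4) :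
    spin Γ u p = ∑ β, Γ p.2.2 β * u (p.1, p.2.1, β) := rfl

/-! ## Link transports and the Wilson hopping term -/

section Links

open Literature.MathematicalPhysics.QuantumLattice Literature.MathematicalPhysics.QuantumFieldTheory


/-- The forward covariant shift `(T_μ u)(x) = U(x,μ) u(x + μ̂)`. -/
def fwd (U : GaugeConfig 4 L SU3) (μ : Fin 4) : Fld L →ₗ[ℂ] Fld L :=
  transport (fun x => ((U (x, μ) : SU3) : Matrix (Fin 3) (Fin 3) ℂ)) (Pi.single μ 1)

/-- The backward covariant shift `(T_μ† u)(x) = U(x - μ̂,μ)⁻¹ u(x - μ̂)`, the adjoint of `fwd`. -/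
def bwd (U : GaugeConfig 4 L SU3) (μ : Fin 4) : Fld L →ₗ[ℂ] Fld L :=
  transport (fun x => (((U (x - Pi.single μ 1, μ))⁻¹ : SU3) : Matrix (Fin 3) (Fin 3) ℂ))
    (-Pi.single μ 1)

/-- Definitional unfolding of `fwd`. -/
theorem fwd_eq (U : GaugeConfig 4 L SU3) (μ : Fin 4) :
    fwd U μ = transport (fun x => ((U (x, μ) : SU3) : Matrix (Fin 3) (Fin 3) ℂ)) (Pi.single μ 1) :=
  rfl

/-- Definitional unfolding of `bwd`. -/
theorem bwd_eq (U : GaugeConfig 4 L SU3) (μ : Fin 4) :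
    bwd U μ = transport (fun x => (((U (x - Pi.single μ 1, μ))⁻¹ : SU3) : Matrix (Fin 3) (Fin 3) ℂ))
      (-Pi.single μ 1) :=
  rfl

/-- The covariant lattice Laplacian in direction `μ`: `K_μ = 2 - T_μ - T_μ†`. -/
def lapK (U : GaugeConfig 4 L SU3) (μ : Fin 4) : Fld L →ₗ[ℂ] Fld L :=
  (2 : ℂ) • LinearMap.id - fwd U μ - bwd U μ

/-- The anti-Hermitian covariant difference in direction `μ`: `a_μ = T_μ - T_μ†`. -/
def asym (U : GaugeConfig 4 L SU3) (μ : Fin 4) : Fld L →ₗ[ℂ] Fld L :=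
  fwd U μ - bwd U μ

/-- The Wilson hopping term in direction `μ`: `E_μ = ½ (K_μ + γ_μ a_μ)`, so that
`D_W = m + Σ_μ E_μ` (`wilsonDirac_mulVec`). -/
def hop (U : GaugeConfig 4 L SU3) (μ : Fin 4) : Fld L →ₗ[ℂ] Fld L :=
  (1 / 2 : ℂ) • (lapK U μ + spin (euclideanGamma μ) ∘ₗ asym U μ)

/-- `K_μ v = 2v - T_μ v - T_μ† v`. -/
theorem lapK_apply (U : GaugeConfig 4 L SU3) (μ : Fin 4) (v : Fld L) :
    lapK U μ v = (2 : ℂ) • v - fwd U μ v - bwd U μ v := rfl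

/-- `a_μ v = T_μ v - T_μ† v`. -/
theorem asym_apply (U : GaugeConfig 4 L SU3) (μ : Fin 4) (v : Fld L) :
    asym U μ v = fwd U μ v - bwd U μ v := rfl

/-- `E_μ v = ½ (K_μ v + γ_μ (a_μ v))`. -/
theorem hop_apply (U : GaugeConfig 4 L SU3) (μ : Fin 4) (v : Fld L) :
    hop U μ v = (1 / 2 : ℂ) • (lapK U μ v + spin (euclideanGamma μ) (asym U μ v)) := rfl

variable [NeZero L]

/-- The curvature potential of the statement at the site `x`:
`V(U,x) = Σ_{y : dist(x,y) ≤ 3} Σ_{μ,ν} √(3 - Re tr U_p(y;μ,ν))`. -/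
def curv (U : GaugeConfig 4 L SU3) (x : TorusSite 4 L) : ℝ :=
  ∑ y ∈ Finset.univ.filter (fun y : TorusSite 4 L => torusDist x y ≤ 3), ∑ μ : Fin 4, ∑ ν : Fin 4,
    Real.sqrt (3 - ((fundamentalRep (Fin 3)) (plaquetteHolonomy U y μ ν)).trace.re)

/-- The curvature-weighted mass `Φ(U,v) = Σ_x V(U,x) |v|²(x)`. -/
def phi (U : GaugeConfig 4 L SU3) (v : Fld L) : ℝ := ∑ x, curv U x * siteSq v x

end Links

end Summit.QuantumFields.QCD.Theorems.WilsonLichnerowicz
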